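import Literature.Barriers.NavierStokesRegularity.NavierStokesInequalityCantorArrangementBridge
import Literature.Barriers.NavierStokesRegularity.NavierStokesInequalityCantorArrangementHolds
import Literature.Barriers.NavierStokesRegularity.NavierStokesInequalitySingularSolutionsAssembly
import HarnessLib

/-!
# Scheffer's singular NSI solution (1985): the barrier fact discharged

Barrier catalogue support file for `NavierStokesRegularity` (D-0021): the DISCHARGE of the
barrier fact `Literature.Barriers.NavierStokesRegularity.NavierStokesInequalitySingularSolution`
of `NavierStokesInequalitySingularSolutions` — V. Scheffer, *A solution to the Navier–Stokes
inequality with an internal singularity*, Comm. Math. Phys. 101 (1985), 47–85, **Theorem 1.1**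
(restated as W. S. Ożański, Nonlinearity 33 (2020), Thm. 1.5; proof re-exposed in W. S. Ożański,
arXiv:1709.00602v4, Thm. 1.1, §§2–5) — together with the two named facts left on its printed
proof path, fact C `NSIArrangementExists` (the geometric arrangement, Ożański §5 = Scheffer §§4, 6)
and fact B `NSIBlockExists` (the classical block, Ożański §4 = Scheffer Lemma 3.3).

Everything is assembled from theorems already in the tree; nothing is asserted, no definitions:

* fact C from fact C′: `nsiArrangementExists_of_cantor` (`NavierStokesInequalityCantorArrangementBridge`:
  Ożański §6.2, p. 28, "the previous geometric arrangement is recovered if one takes `ξ = 0`,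
  `M = 1`" — keep the first similarity of a Cantor arrangement) applied to the proved
  `NSICantorArrangementExists_holds` (`NavierStokesInequalityCantorArrangementHolds`: §6.5 over §5,
  Theorem 3.4 through `Ozanski2017_cutoff_rect_holds` / `Ozanski2017_cutoff_ring_holds`);
* fact B from fact C and the proved fact D (`NSIBlock_of_arrangement_holds`,
  `NavierStokesInequalityProfilesProofs`): `nsiBlockExists_of_nsiArrangementExists`
  (`NavierStokesInequalitySingularSolutionsAssembly`);
* the barrier fact from fact C, facts A (`nsiSwitching_holds`, `SchefferSwitchedSolution`) and D
  being proved: `navierStokesInequalitySingularSolution_of_nsiArrangementExists`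
  (`NavierStokesInequalitySingularSolutionsAssembly`; Scheffer 1985, p. 84: "Theorem 1.1 is a
  consequence of Lemma 6.4, Lemma 3.3 and Lemma 2.4").

## References

* V. Scheffer, Comm. Math. Phys. 101 (1985), 47–85: Thm. 1.1 and p. 84; Lemmas 2.3–2.4, 3.3,
  6.1–6.4. [`Scheffer1985`]
* W. S. Ożański, *On weak solutions to the Navier–Stokes inequality with internal singularities*,
  arXiv:1709.00602v4 (2017/2019): Thm. 1.1, §2 (p. 7), §4 (Prop. 4.2), §5, §6.2 (p. 28), §6.5.
  [`Ozanski2017NSISingular`]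
* W. S. Ożański, Nonlinearity 33 (2020), Thm. 1.5. [`Ozanski2019NSI`]
-/

noncomputable section

namespace Literature.Barriers.NavierStokesRegularity

/-- **Fact C holds: the geometric arrangement for the one-point blow-up exists** (Ożański 2017,
§5; Scheffer 1985, §§4, 6), obtained from the Cantor arrangement of §6.5
(`NSICantorArrangementExists_holds`, any `ξ ∈ (0,1)`) by forgetting all similarities but the
first (`nsiArrangementExists_of_cantor`; Ożański §6.2, p. 28).
[cite: Ozanski2017NSISingular, §5 and §6.2 p. 28] [cite: Scheffer1985, §4, §6 (Lemmas 6.1–6.3)] -/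
theorem NSIArrangementExists_holds : NSIArrangementExists :=
  nsiArrangementExists_of_cantor NSICantorArrangementExists_holds

/-- **Fact B holds: a classical block exists** (Ożański 2017, §4, opening paragraph and Prop. 4.2;
Scheffer 1985, Lemma 3.3 with §6): fact C (`NSIArrangementExists_holds`) and the proved fact D
(`NSIBlock_of_arrangement_holds`) through `nsiBlockExists_of_nsiArrangementExists`.
[cite: Ozanski2017NSISingular, §4 (opening paragraph, Prop. 4.2)] [cite: Scheffer1985, Lemma 3.3] -/
theorem NSIBlockExists_holds : NSIBlockExists :=
  nsiBlockExists_of_nsiArrangementExists NSIArrangementExists_holds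

/-- **Scheffer's theorem holds (Scheffer 1985, Thm. 1.1; Ożański 2020, Thm. 1.5): there is a weak
solution of the Navier–Stokes inequality, for every viscosity `ν ∈ [0, ν₀]`, with smooth compactly
supported slices and an internal singular point.** The discharge of the barrier fact
`NavierStokesInequalitySingularSolution` along its printed proof (Scheffer, p. 84: "Theorem 1.1
is a consequence of Lemma 6.4, Lemma 3.3 and Lemma 2.4"; Ożański 2017, §2, p. 7): the switching
principle (fact A, `nsiSwitching_holds`), the block from the arrangement (fact D,
`NSIBlock_of_arrangement_holds`) and the arrangement (fact C, `NSIArrangementExists_holds`),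
through `navierStokesInequalitySingularSolution_of_nsiArrangementExists`.
[cite: Scheffer1985, Thm. 1.1 and p. 84] [cite: Ozanski2019NSI, Thm. 1.5] [cite: Ozanski2017NSISingular, Thm. 1.1, §2 p. 7] -/
theorem NavierStokesInequalitySingularSolution_holds : NavierStokesInequalitySingularSolution :=
  navierStokesInequalitySingularSolution_of_nsiArrangementExists NSIArrangementExists_holds

end Literature.Barriers.NavierStokesRegularity

end
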